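import Literature.Computability.AlgebraicComplexity.Kron444HullCheck
import HarnessLib

/-!
# `Kron(4,4,4) ⊆ conv(328 vertices)`: certificate checks, part 7/14

Proofs file (computations only): the node checks of `Kron444HullCheck.lean` for the chunks
81 … 95 of the certificate, each decided by the kernel (`decide +kernel`; `maxHeartbeats 0`:
a chunk is ≈ 10⁵–10⁶ kernel reductions). Assembled in `Kron444Hull.lean`. [folklore]
-/

set_option Elab.async false

namespace Literature.Computability.AlgebraicComplexity.Kron444Hull

/-- Nodes `2025 … 2049` of the certificate (chunk `81`) pass `checkNodeRec`. [folklore] -/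
theorem checkChunk_81 : checkChunk 81 25 = true := by
  set_option maxHeartbeats 0 in decide +kernel

/-- Nodes `2050 … 2074` of the certificate (chunk `82`) pass `checkNodeRec`. [folklore] -/
theorem checkChunk_82 : checkChunk 82 25 = true := by
  set_option maxHeartbeats 0 in decide +kernel

/-- Nodes `2075 … 2099` of the certificate (chunk `83`) pass `checkNodeRec`. [folklore] -/
theorem checkChunk_83 : checkChunk 83 25 = true := by
  set_option maxHeartbeats 0 in decide +kernel

/-- Nodes `2100 … 2124` of the certificate (chunk `84`) pass `checkNodeRec`. [folklore] -/
theorem checkChunk_84 : checkChunk 84 25 = true := by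
  set_option maxHeartbeats 0 in decide +kernel

/-- Nodes `2125 … 2149` of the certificate (chunk `85`) pass `checkNodeRec`. [folklore] -/
theorem checkChunk_85 : checkChunk 85 25 = true := by
  set_option maxHeartbeats 0 in decide +kernel

/-- Nodes `2150 … 2174` of the certificate (chunk `86`) pass `checkNodeRec`. [folklore] -/
theorem checkChunk_86 : checkChunk 86 25 = true := by
  set_option maxHeartbeats 0 in decide +kernel

/-- Nodes `2175 … 2199` of the certificate (chunk `87`) pass `checkNodeRec`. [folklore] -/
theorem checkChunk_87 : checkChunk 87 25 = true := by
  set_option maxHeartbeats 0 in decide +kernel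

/-- Nodes `2200 … 2224` of the certificate (chunk `88`) pass `checkNodeRec`. [folklore] -/
theorem checkChunk_88 : checkChunk 88 25 = true := by
  set_option maxHeartbeats 0 in decide +kernel

/-- Nodes `2225 … 2249` of the certificate (chunk `89`) pass `checkNodeRec`. [folklore] -/
theorem checkChunk_89 : checkChunk 89 25 = true := by
  set_option maxHeartbeats 0 in decide +kernel

/-- Nodes `2250 … 2274` of the certificate (chunk `90`) pass `checkNodeRec`. [folklore] -/
theorem checkChunk_90 : checkChunk 90 25 = true := by
  set_option maxHeartbeats 0 in decide +kernel

/-- Nodes `2275 … 2299` of the certificate (chunk `91`) pass `checkNodeRec`. [folklore] -/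
theorem checkChunk_91 : checkChunk 91 25 = true := by
  set_option maxHeartbeats 0 in decide +kernel

/-- Nodes `2300 … 2324` of the certificate (chunk `92`) pass `checkNodeRec`. [folklore] -/
theorem checkChunk_92 : checkChunk 92 25 = true := by
  set_option maxHeartbeats 0 in decide +kernel

/-- Nodes `2325 … 2349` of the certificate (chunk `93`) pass `checkNodeRec`. [folklore] -/
theorem checkChunk_93 : checkChunk 93 25 = true := by
  set_option maxHeartbeats 0 in decide +kernel

/-- Nodes `2350 … 2374` of the certificate (chunk `94`) pass `checkNodeRec`. [folklore] -/
theorem checkChunk_94 : checkChunk 94 25 = true := by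
  set_option maxHeartbeats 0 in decide +kernel

/-- Nodes `2375 … 2399` of the certificate (chunk `95`) pass `checkNodeRec`. [folklore] -/
theorem checkChunk_95 : checkChunk 95 25 = true := by
  set_option maxHeartbeats 0 in decide +kernel

end Literature.Computability.AlgebraicComplexity.Kron444Hull
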